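import Summits.AtomisticToContinuum.HydrodynamicLimit.Theorems.CollisionIsometryCLTAdaptedWeightCLTTimeLocal
import Literature.Analysis.FluidPDE.HardSphereFlowGroup
import Literature.Analysis.FluidPDE.HardSphereRegularGeometry

/-!
# Stub `stub_flowDictionary` of the line `contact-source-duhamel`
(crux `CollisionIsometryCLT.AdaptedWeightCLT`, stmt-AtomisticToContinuum-14868, the rev-12
time-local crux; `--supports`)

-- adapted from Theorems/CollisionIsometryCLTAdaptedWeightCLTStubFlowDictionary.lean

RE-HOME under the namespace `…ContactSourceDuhamel.TimeLocal.FlowDict` of the proof accepted as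
p86282 (tree file `Theorems/CollisionIsometryCLTAdaptedWeightCLTStubFlowDictionary.lean`, namespace
`…ContactSourceDuhamel.FlowDict`). That file imports the rev-11 statements module
`Theorems/CollisionIsometryCLTAdaptedWeightCLTStatements.lean`, which no longer elaborates since
the route restatement of rev 12 (`lean check` rc 1: type mismatch `Iff.rfl` at
`adaptedWeightCLT_iff`) and cannot be amended append-only; hence neither module is importable for
the rev-12 item. The predicate `TimeLocal.FlowDictionary` (module `…AdaptedWeightCLTTimeLocal`)
has the byte-identical body, and the proof below is the p86282 proof verbatim against it. The
helper lemmas (`regular_hsDiameter`, `pre_of_eq_top`, `not_nonempty_incomingPairs_of_eq_top`,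
`vel_collisionStep`, `vel_stateAfter`, `vel_fwdFlow`) stay public: the line's `stub_reduction`
imports them from here.

THE FOLD IS THE FLOW, Liouville-almost surely and uniformly in time: for `0 < σ < 1/2`,
`FlowDictionary σ`, i.e. for every `N`, every hard-sphere flow `Φ` of `N + 1` spheres of diameter
`hsDiameter σ N` on `𝕋³`, Liouville-a.e. `z`, all `s` and all `Δ ≥ 0`,
`(i ↦ (Φ_{s+Δ} z i).2) = velAfter σ N (Φ_s z) (steps σ N (Φ_s z) Δ)` — the uniform-in-`(s, Δ)` form
of the route's support item `TransferRepresentsFlow` (stmt-12952).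

Proof.
1. PURE UNFOLDING (`vel_stateAfter`, every `y`, every `k`): the velocities of the `k`-th state
   `Alexander.stateAfter y k` of the collision-by-collision construction are `velAfter σ N y k`, by
   induction on `k`: `stateAfter (k+1) = collisionStep (stateAfter k)` against
   `transferSteps (k+1) = stepMap k ∘ transferSteps k`; one step (`vel_collisionStep`) is the
   observation that the crux's `stepMap k` and `collisionStep` test the SAME incoming pairs of
   `pre k = freeFlight τ (stateAfter k)`, that free flight keeps the velocities, and that the case
   `τ = ∞` is the identity on both sides — an incoming contact pair would force `τ = 0` in a regular
   geometry (`Alexander.freeExitTime_eq_zero_of_isIncoming`; the torus geometry is regular at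
   diameter `hsDiameter σ N ≤ σ < 1/2`, `Torus.isHardSphereRegular_geometry`).
2. ON THE GOOD SET (`stub_flowDictionary`): for `z ∈ Φ.good` (conull, `HardSphereFlow.ae_mem_good`)
   and any `s`, `y := Φ_s z` is good (`mapsTo_good`), `u ↦ Φ_u y` is a hard-sphere trajectory
   through `y` at `u = 0` (`isTrajectory`, `flow_zero`), so the Alexander forward flow reproduces it
   (`IsHardSphereTrajectory.fwdFlow_apply_zero`): `fwdFlow y Δ = Φ_Δ y = Φ_{s+Δ} z` (`flow_add`);
   and `fwdFlow y Δ = freeFlight _ (stateAfter y (collisionCount y Δ))` by definition, whose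
   velocities are `velAfter σ N y (steps σ N y Δ)` by 1 (`vel_fwdFlow`).
-/

namespace Summit.AtomisticToContinuum.HydrodynamicLimit.Theorems.ContactSourceDuhamel.TimeLocal.FlowDict

open scoped BigOperators Topology Classical MeasureTheory ENNReal InnerProductSpace
open Filter Set MeasureTheory
open Literature.Analysis.FluidPDE
open Literature.MathematicalPhysics.KineticTheory (hsDiameter hsDiameter_le)

noncomputable section

variable {σ : ℝ} {N : ℕ}

/-- The torus geometry is hard-sphere regular at the diameter `hsDiameter σ N ≤ σ < 1/2`
(`Torus.isHardSphereRegular_geometry`). -/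
theorem regular_hsDiameter (hσ : 0 ≤ σ) (hσ2 : σ < 2⁻¹) (N : ℕ) :
    (Torus.geometry (Fin 3)).IsHardSphereRegular (hsDiameter σ N) :=
  Torus.isHardSphereRegular_geometry ((hsDiameter_le hσ N).trans_lt hσ2)

/-- If the `k`-th free flight of the Alexander construction never ends, the pre-collisional
configuration `pre k` is the `k`-th state itself (`∞.toReal = 0`, `freeFlight 0 = id`). -/
theorem pre_of_eq_top (y : Cfg N) (k : ℕ)
    (htop : Alexander.freeExitTime (Torus.geometry (Fin 3)) (hsDiameter σ N)
      (Alexander.stateAfter (Torus.geometry (Fin 3)) (hsDiameter σ N) y k) = ∞) :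
    pre σ N y k = Alexander.stateAfter (Torus.geometry (Fin 3)) (hsDiameter σ N) y k := by
  unfold pre
  rw [htop, ENNReal.toReal_top, freeFlight_zero]

/-- In a regular geometry a state whose free flight never ends has no incoming contact pair
(an incoming contact pair forces `τ = 0`, `Alexander.freeExitTime_eq_zero_of_isIncoming`). -/
theorem not_nonempty_incomingPairs_of_eq_top
    (hG : (Torus.geometry (Fin 3)).IsHardSphereRegular (hsDiameter σ N)) {z : Cfg N}
    (htop : Alexander.freeExitTime (Torus.geometry (Fin 3)) (hsDiameter σ N) z = ∞) :
    ¬(Alexander.incomingPairs (Torus.geometry (Fin 3)) (hsDiameter σ N) z).Nonempty := by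
  rintro ⟨p, hp⟩
  obtain ⟨hlt, hc, hin⟩ := Alexander.mem_incomingPairs.1 hp
  have h0 := Alexander.freeExitTime_eq_zero_of_isIncoming hG hlt.ne hc hin
  rw [htop] at h0
  exact ENNReal.top_ne_zero h0

/-- ONE FOLD STEP IS ONE COLLISION STEP (pure unfolding, every `y`, every `k`): the velocities of
`collisionStep (stateAfter y k)` are `stepMap k` applied to the velocities of `stateAfter y k` —
both `dite`s test the same incoming pairs of `pre k = freeFlight τ (stateAfter y k)`, free flight
keeps velocities, and the case `τ = ∞` is an identity step on both sides (regular geometry). -/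
theorem vel_collisionStep (hG : (Torus.geometry (Fin 3)).IsHardSphereRegular (hsDiameter σ N))
    (y : Cfg N) (k : ℕ) :
    (fun i => (Alexander.collisionStep (Torus.geometry (Fin 3)) (hsDiameter σ N)
      (Alexander.stateAfter (Torus.geometry (Fin 3)) (hsDiameter σ N) y k) i).2) =
      stepMap σ N y k
        (fun i => (Alexander.stateAfter (Torus.geometry (Fin 3)) (hsDiameter σ N) y k i).2) := by
  unfold stepMap Alexander.collisionStep
  by_cases htop : Alexander.freeExitTime (Torus.geometry (Fin 3)) (hsDiameter σ N)
      (Alexander.stateAfter (Torus.geometry (Fin 3)) (hsDiameter σ N) y k) = ∞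
  · have hne : ¬(Alexander.incomingPairs (Torus.geometry (Fin 3)) (hsDiameter σ N)
        (pre σ N y k)).Nonempty := by
      rw [pre_of_eq_top y k htop]
      exact not_nonempty_incomingPairs_of_eq_top hG htop
    rw [if_pos htop, dif_neg hne]
  · rw [if_neg htop]
    by_cases hne : (Alexander.incomingPairs (Torus.geometry (Fin 3)) (hsDiameter σ N)
        (pre σ N y k)).Nonempty
    · have hne' : (Alexander.incomingPairs (Torus.geometry (Fin 3)) (hsDiameter σ N)
          (freeFlight (Torus.geometry (Fin 3))
            (Alexander.freeExitTime (Torus.geometry (Fin 3)) (hsDiameter σ N)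
              (Alexander.stateAfter (Torus.geometry (Fin 3)) (hsDiameter σ N) y k)).toReal
            (Alexander.stateAfter (Torus.geometry (Fin 3)) (hsDiameter σ N) y k))).Nonempty := hne
      rw [dif_pos hne, dif_pos hne']
      rfl
    · have hne' : ¬(Alexander.incomingPairs (Torus.geometry (Fin 3)) (hsDiameter σ N)
          (freeFlight (Torus.geometry (Fin 3))
            (Alexander.freeExitTime (Torus.geometry (Fin 3)) (hsDiameter σ N)
              (Alexander.stateAfter (Torus.geometry (Fin 3)) (hsDiameter σ N) y k)).toReal
            (Alexander.stateAfter (Torus.geometry (Fin 3)) (hsDiameter σ N) y k))).Nonempty := hne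
      rw [dif_neg hne, dif_neg hne']
      rfl

/-- PURE UNFOLDING (every `y`, every `k`, regular geometry): the velocities of the `k`-th
post-collisional state of the Alexander construction started at `y` are the fold velocities
`velAfter σ N y k` (induction on `k`: `stateAfter_succ` against `transferSteps (k+1) = stepMap k ∘
transferSteps k`, one step being `vel_collisionStep`). -/
theorem vel_stateAfter (hG : (Torus.geometry (Fin 3)).IsHardSphereRegular (hsDiameter σ N))
    (y : Cfg N) (k : ℕ) :
    (fun i => (Alexander.stateAfter (Torus.geometry (Fin 3)) (hsDiameter σ N) y k i).2) =
      velAfter σ N y k := by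
  induction k with
  | zero => rfl
  | succ k ih =>
    have hsucc : velAfter σ N y (k + 1) = stepMap σ N y k (velAfter σ N y k) :=
      transferSteps_succ σ N y k _
    rw [hsucc, ← ih, Alexander.stateAfter_succ]
    exact vel_collisionStep hG y k

/-- The velocities of the forward Alexander flow at time `Δ` are the fold velocities after
`steps σ N y Δ` steps (`fwdFlow y Δ = freeFlight _ (stateAfter y (collisionCount y Δ))` by
definition, free flight keeps velocities, and `vel_stateAfter`). -/
theorem vel_fwdFlow (hG : (Torus.geometry (Fin 3)).IsHardSphereRegular (hsDiameter σ N))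
    (y : Cfg N) (Δ : ℝ) :
    (fun i => (Alexander.fwdFlow (Torus.geometry (Fin 3)) (hsDiameter σ N) y Δ i).2) =
      velAfter σ N y (steps σ N y Δ) := by
  rw [← vel_stateAfter hG y (steps σ N y Δ)]
  rfl

/-- **FLOW DICTIONARY** (`stub_flowDictionary` of the line `contact-source-duhamel`): for
`0 < σ < 1/2`, every `N` and every hard-sphere flow `Φ` of `N + 1` spheres of diameter
`hsDiameter σ N` on `𝕋³`, for Liouville-a.e. `z` (namely on the conull good set of `Φ`), for all
`s` and all `Δ ≥ 0`, the velocities of `Φ_{s+Δ} z` are the crux's fold over `[0, Δ]` restarted at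
`Φ_s z` applied to the velocities of `Φ_s z`. Proof: `y := Φ_s z` is good, `u ↦ Φ_u y` is a
hard-sphere trajectory through `y` at `u = 0`, so the Alexander forward flow reproduces it
(`IsHardSphereTrajectory.fwdFlow_apply_zero`, regular geometry since `hsDiameter σ N ≤ σ < 1/2`):
`fwdFlow y Δ = Φ_Δ y = Φ_{s+Δ} z` (group law on the good set); and the velocities of `fwdFlow y Δ`
are `velAfter σ N y (steps σ N y Δ)` by pure unfolding (`vel_fwdFlow`). -/
theorem stub_flowDictionary : ∀ σ : ℝ, 0 < σ → σ < 2⁻¹ → FlowDictionary σ := by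
  intro σ hσ hσ2 N Φ
  have hG := regular_hsDiameter hσ.le hσ2 N
  filter_upwards [Φ.ae_mem_good] with z hz s Δ hΔ
  have hy : Φ.flow s z ∈ Φ.good := Φ.mapsTo_good s hz
  have hfwd : Alexander.fwdFlow (Torus.geometry (Fin 3)) (hsDiameter σ N)
      (Φ.flow 0 (Φ.flow s z)) Δ = Φ.flow Δ (Φ.flow s z) :=
    (Φ.isTrajectory _ hy).fwdFlow_apply_zero hG hΔ
  rw [Φ.flow_zero _ hy, ← Φ.flow_add Δ s z hz, add_comm Δ s] at hfwd
  rw [← hfwd]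
  exact vel_fwdFlow hG (Φ.flow s z) Δ

end

end Summit.AtomisticToContinuum.HydrodynamicLimit.Theorems.ContactSourceDuhamel.TimeLocal.FlowDict
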